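import Summits.Ventures.QEC.Census.LRATLeaves
import Summits.Ventures.QEC.Census.KernelReplayFastSound
import HarnessLib

/-!
# Fast kernel replay of kernel-B LEAF refutations (glue: `leafCNF` / `coverCNF` ↔ `KRupFast`)

Cell `qec`, PARTITION row type-11 (K2).  A kernel-B certificate leaf is the CNF
`leafCNF n rows us w cs qs = Q_any(rows, us, w) ++ units (cs ++ qs)` (`Census/LRATLeaves.lean`); its
kernel-tier refutation modules (emitted from the solver's LRAT proof) state the replay over the CLAUSE
LIST in the `KRup` literal convention,
`(cnfEncodeAnyClauses n rows us w ++ units (cs ++ qs)).map KernelReplay.clauseToKRup`,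
or — to avoid re-evaluating the encoder in every module — over `base ++ (units (cs ++ qs)).map clauseToKRup`
with a ONCE-proved data identity `hbase : (cnfEncodeAnyClauses n rows us w).map clauseToKRup = base`.
This file turns an accepted `KRupFast.checkAll … && hasEmpty …` verdict of either shape into
`(leafCNF n rows us w cs qs).Unsat` (the hypothesis `hleaf` of the assembly theorems in
`LRATLeavesBB.lean` / `LRATLeavesBBParity.lean` / `LRATLeavesFree.lean`), and provides the store-invariant
entry point `all_ofClauses_leafCNF` for leaves whose LRAT proof is CHAINED over several modules
(continue with `KRupFast.all_advance_of_checkAll`, finish with `KRupFast.false_of_checkAll_of_hasEmpty`).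
Measured (farm, `decide +kernel`, BB144 `W = 10` leaf with 21 431 hints): encoder evaluation ≈ 30 s once,
store build ≈ 3 s, replay ≈ 0.33 ms/hint.
-/

namespace Summit.Ventures.QEC.Census.KRupFast

open Std.Sat Summit.Ventures.QEC.Census.CNFEncode Summit.Ventures.QEC.Census.LRATBridge
open Summit.Ventures.DiscreteObjects.UnitDistance

/-- `cnfToKRup` of a CNF given by a clause list is the mapped list. -/
theorem cnfToKRup_mk (l : List (CNF.Clause Nat)) :
    KernelReplay.cnfToKRup (⟨l.toArray⟩ : CNF Nat) = l.map KernelReplay.clauseToKRup := by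
  simp [KernelReplay.cnfToKRup]

/-- The `KRup` clause list of a leaf CNF. -/
theorem cnfToKRup_leafCNF (n : ℕ) (rows us : List (List ℕ)) (w : ℕ) (cs qs : List (Literal ℕ)) :
    KernelReplay.cnfToKRup (leafCNF n rows us w cs qs) =
      (cnfEncodeAnyClauses n rows us w).map KernelReplay.clauseToKRup ++
        (units (cs ++ qs)).map KernelReplay.clauseToKRup := by
  rw [leafCNF_eq_mk, cnfToKRup_mk, List.map_append]

/-- The number of clauses of a leaf CNF. -/
theorem size_leafCNF (n : ℕ) (rows us : List (List ℕ)) (w : ℕ) (cs qs : List (Literal ℕ)) :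
    (leafCNF n rows us w cs qs).clauses.size = (cnfEncodeAnyClauses n rows us w).length + (cs ++ qs).length := by
  rw [leafCNF_eq_mk]
  simp [units]

/-- **Leaf refutation, cached-base shape**: with the data identity `hbase` (the encoder's clause list in
`KRup` literals IS the literal list `base`, proved once per certificate by `decide`), an accepted fast
replay over `base ++ units` refutes the leaf CNF. -/
theorem leafCNF_unsat_of_checkAll {f d E N n w : ℕ} (hE : E = evenMask N) {rows us : List (List ℕ)}
    {cs qs : List (Literal ℕ)} {base : List (List ℕ)}
    (hbase : (cnfEncodeAnyClauses n rows us w).map KernelReplay.clauseToKRup = base)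
    {steps : List (List ℕ × List ℕ)}
    (h : (checkAll f d E (Store.ofClauses d (base ++ (units (cs ++ qs)).map KernelReplay.clauseToKRup))
          (base.length + (cs ++ qs).length + 1) steps && hasEmpty steps) = true) :
    (leafCNF n rows us w cs qs).Unsat := by
  rw [Bool.and_eq_true] at h
  intro σ
  by_contra hsat
  rw [Bool.not_eq_false] at hsat
  have hS := all_ofClauses_cnf (σ := σ) d (cnf := leafCNF n rows us w cs qs) hsat
  rw [cnfToKRup_leafCNF, hbase] at hS
  exact false_of_checkAll_of_hasEmpty hE hS h.1 h.2

/-- **Leaf refutation, encoder shape** (the module lets the kernel evaluate the encoder). -/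
theorem leafCNF_unsat_of_checkAll' {f d E N n w : ℕ} (hE : E = evenMask N) {rows us : List (List ℕ)}
    {cs qs : List (Literal ℕ)} {steps : List (List ℕ × List ℕ)}
    (h : (checkAll f d E (Store.ofClauses d
            ((cnfEncodeAnyClauses n rows us w ++ units (cs ++ qs)).map KernelReplay.clauseToKRup))
          ((cnfEncodeAnyClauses n rows us w).length + (cs ++ qs).length + 1) steps && hasEmpty steps) = true) :
    (leafCNF n rows us w cs qs).Unsat := by
  refine leafCNF_unsat_of_checkAll (f := f) (d := d) (steps := steps)
    (base := (cnfEncodeAnyClauses n rows us w).map KernelReplay.clauseToKRup) hE rfl ?_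
  rw [List.length_map, ← List.map_append]
  exact h

/-- CHAIN ENTRY for a leaf whose proof spans several modules: under any assignment satisfying the leaf
CNF, the store of `base ++ units` satisfies the invariant (then `all_advance_of_checkAll` per segment,
`false_of_checkAll_of_hasEmpty` at the end). -/
theorem all_ofClauses_leafCNF {σ : ℕ → Bool} (d : ℕ) {n w : ℕ} {rows us : List (List ℕ)}
    {cs qs : List (Literal ℕ)} {base : List (List ℕ)}
    (hbase : (cnfEncodeAnyClauses n rows us w).map KernelReplay.clauseToKRup = base)
    (hsat : (leafCNF n rows us w cs qs).eval σ = true) :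
    (Store.ofClauses d (base ++ (units (cs ++ qs)).map KernelReplay.clauseToKRup)).All (MaskSat σ) := by
  have hS := all_ofClauses_cnf (σ := σ) d (cnf := leafCNF n rows us w cs qs) hsat
  rwa [cnfToKRup_leafCNF, hbase] at hS

/-- A leaf CNF is UNSAT once some assignment-indexed contradiction is available (packaging for emitted
chain modules: they prove `∀ σ, (leafCNF …).eval σ = true → False`). -/
theorem leafCNF_unsat_of_forall {n w : ℕ} {rows us : List (List ℕ)} {cs qs : List (Literal ℕ)}
    (h : ∀ σ : ℕ → Bool, (leafCNF n rows us w cs qs).eval σ = true → False) :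
    (leafCNF n rows us w cs qs).Unsat := by
  intro σ
  by_contra hsat
  rw [Bool.not_eq_false] at hsat
  exact h σ hsat

/-- **Cover refutation**: the completeness CNF of a cube family (`coverCNF o cubes`, tiny) refuted by the
fast replay. -/
theorem coverCNF_unsat_of_kernelRupFast {f d E N o : ℕ} (hE : E = evenMask N)
    {cubes : List (List (Literal ℕ))} {steps : List (List ℕ × List ℕ)}
    (h : kernelRupFast f d E (coverCNF o cubes) steps = true) : (coverCNF o cubes).Unsat :=
  unsat_of_kernelRupFast hE h

end Summit.Ventures.QEC.Census.KRupFast
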